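import Literature.MathematicalPhysics.QuantumFieldTheory.Balaban1983to89.B9SectCWalkTermsAllNorms
import Literature.MathematicalPhysics.QuantumFieldTheory.Balaban1983to89.DagBinding

/-!
# `Balaban1983to89.B9Carve08Thm39Hyp` — T. Bałaban, *Propagators for lattice gauge theories in a background field*,
# Commun. Math. Phys. **99** (1985) 389–434 [Balaban1985BackgroundPropagators]: pp. 410–414 (Corollary 3.8, Theorem 3.9,
# (3.90)–(3.105)) — the residual printed statements in hypothesis form and ONE bundle keyed to the consumer

statement-level skeleton of published theorems with citation tags; proofs where landed; nothing here is a claim about the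
Yang–Mills mass gap

PDF held: `paper:balaban1985-cmp99-background-propagators` (journal page = PDF page + 388; pp. 409–414 = PDF 21–26 re-read
as IMAGES by this seat, renders `carve-08/renders/original-p021…p026-x2.png` of the held `original.pdf`).

CITATION HEADER (lean-in-tree rule).  P6 CARVING FAN block 08 (cell `lit-balaban`, `carve/BLOCKS-01-10.md` row 08,
rules `carve/CARVE-RULES.md`): [B9] pp. 410–414 — Corollary 3.8, Theorem 3.9 and the displays (3.90)–(3.105).  KEY item
(consumer) `stmt-QuantumFields-20542` (K1⁷, lane N06 [B9]); also-feeds `stmt-QuantumFields-19200` (M5.6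
`B9Thm39CinvTorusRegular`, not started: the printed INPUTS of the proof of Theorem 3.9 are named below as hypotheses).

IN TREE = CITED, NEVER RESTATED.  Every SKELETON row of this block has a decl of record, and so do the kernel-level
hypothesis schemas of the printed proof.  Row → decl: **B9.Cor3.8** `B9.Cor38Printed` (sup entry (3.94)), its last
sentence *«Similar estimates hold for the other norms»* `B9SectCWalkTermsAllNorms.Cor38AllNormsPrinted`, pinned reading
`B9Cor38Whole.cor38Printed_of_local342`; **B9.Thm3.9** `B9.Thm39Printed` + the leaf *«This theorem implies Theorem 3.2»*
`B9.RWKernelSumYields` ∕ `B9.thm32_of_thm39`, pinned reading `B9Thm39Whole.thm39Printed_of_local348` with the displayed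
hypothesis schemas `B9Thm39Whole.StaticOK39`, `Local348` ((3.48) for every C_□), `Identities395`, `Small285` (p. 411 *«the
operator R is small»*, (2.85)-shape of [4]), `Factors389` (p. 413 *«a bound of the type (3.89)»*), `Locality39` (p. 413 *«it
depends on U restricted to X̃⁵»*); **B9.Eq3.91** ((3.91)–(3.93)) `B9Thm37Sum.lchain`, `LB`, `lchain_weight_le` ((3.92)),
`B9Cor38Whole.minLen` ((3.93)); **B9.Eq3.95** ((3.95)–(3.96)) `B9Thm39Sum.eq395_sum`, `inverse_of_395`,
`firstSum_term_majorant` (p. 411 separation used as `hsep`), `B9.exp_neg_le_six_div_cube` ∕ `B9.p411_constant` (p. 411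
*«e^{−(1/4)δ₀M} ≧ [sic; ≦] 3!(1/4 δ₀M)^{−3} … the factor 8δ₀^{−1}M^{−1}»*); **B9.Eq3.97** `B9Eq395Small.regroup_412` (the two
unnumbered displays of p. 412), `hasMajorant_comm_mulOp_sq` (*«The commutator in the first term gives O(M^{−1})»*),
`term397_majorant` ∕ `term397_small_factor` (*«(2δ₀M)^{−1}»*), `thirdSum_small_factor` (*«already localized and give small
factors O(M^{−1})»*), `B9SectCDiffEstimate` (`EstHyp.core_diff_entry`, the [2]-difference estimate, THEOREM D lineage);
**B9.Eq3.100** ((3.100)–(3.104)) `B9Eq3105Sum.covD_smul_fun`, `eq3101`, `kerOp` ∕ `commKer` (the unnumbered Q_j-kernel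
display p. 414), `eq3102`, `eq3103`, `eq3104`, the sizes *«O(M^{−1}), or O(M^{−2})»* `B9Eq3104CommutatorSizes*` (desk
G-B9-LETTERS, off-limits); **B9.Eq3.105** `B9Eq3105Sum.eq3105_sum`, `remainder_zeta_eq` (p. 414 *«R satisfies the bound (3.85)
with O(M^{−1})»* is Theorem 3.10's input: `B9Thm310Whole.Factors389`, block 09).  The 𝒟′ ∕ □₀ geometry of pp. 411–413
(*«□₀ the cube □̃²»*, *«a sum of 5^d cubes»*, *«the distance from □̃ to □̃₀ᶜ is at least M»*) is PROVED in the coordinate model: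
`B9SectCCubes.box0_eq`, `card_shifts`, `dist_tilde_compl`, `case2_subset`, `finer_meeting_subset_box0`.  Theorem 3.7 (3.90)
itself is block 07 (`B9.Thm37Printed`).

WHAT THIS FILE DECLARES (26 declarations; hypothesis-form `Prop`s with the verbatim sentence and locator, definitions
with bodies, kernel-checked bookkeeping; NOTHING of the paper is asserted).
* §1 the residual printed statements of pp. 410–414 with NO row ∕ decl: `RemarkP410DecayRatePrinted` (p. 410 remark,
  decay rate arbitrarily close to that of the localized propagators); `SeparationP411Printed` (p. 411, 1 − □̃ vs. h_□ at
  distance ≧ ML^jη); `HprimeOneOnTildeP412Printed` (p. 412, h′_{□₀} = 1 on □̃); `Eq397DifferenceFactorPrinted` (p. 412, the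
  [2]-estimate of (3.97): usual factors × e^{−2δ₀M}); `IsConnectedFamily`, `locDomain`, `IsLocalizationDomainPrinted`
  (p. 413, the DEFINITIONS of connected families of cubes and localization domains, with bodies); `RFactorKernelSupportP413Printed`
  (p. 413, *«its kernel has a support in X × X»* — the two-sided clause; `Factors389` carries the source side);
  `ZetaOneNearBoxP414Printed`, `ZetaSeparationP414Printed` (p. 414, the cut-off ζ_□̃ of (3.105)).
* §2 the bundle `Hyp` (fields `c38`, `c38an`, `t39`, `ksum` = Cor. 3.8, its all-norms sentence, Thm 3.9, the kernel-summation
  leaf, BY NAME over the carriers of `…B9`) keyed to the consumer (`DagBinding.B9Leaf.c38 ∕ .t39`, `B9LeafKnit`'s `hksum`), with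
  `Hyp.t32` (*«This theorem implies Theorem 3.2»*); `HypAt (Y : DagBinding.PrintedCarriers9) termK` — the same at the consumer's
  carrier record, with `hypAt_of_b9Leaf` ∕ `HypAt.leafFields` (the leaf's `c38`, `t39` + `hksum` ⇄ the bundle).  The proof-internal inputs of §1 are NOT conjoined into `Hyp` (they carry
  partition-level letters a node prover never holds); M5.6 takes them by name.
HONEST SCOPE.  Hypothesis-schema typing over EXISTING carriers (`B9.Geometry`, `B9.Backgrounds`, `B9.KernelFamily`,
`B9.RWExpansion`, `B9.RWKernelExpansion`, `B9.SiteKernel`) and Mathlib sets ∕ metric spaces; lengths of §1's geometric clauses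
in the printed unit ℓ = L^jη (*«on L^{−j}-scale»*, p. 412; ℓ = 1 in the coordinates of `B9SectCCubes`); smoothness *«C₀^∞»* of
lattice cut-offs is not typed (print's gradient bounds live in [4] Sect. A); the grouping combinatorics of p. 412 (*«At a worst
case we have three operators attached …»*, *«it is possible only if □′ = □₀»*) and the remark on heteromorphic factors (p. 413)
are prose and are not typed.  No summit statement is proved by this seat; count-neutral; nothing continuum ∕ mass-gap ∕ Clay.
Seat `lit-balaban-carve-08` (literature-prover), HOME `run/shared/lean/pub/lit-balaban/carve/`, 2026-08-28.
-/

namespace Literature.MathematicalPhysics.QuantumFieldTheory.Balaban1983to89.B9Carve08Thm39Hyp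

open B9 DagBinding

/-! ## §1 Residual printed statements of pp. 410–414 (hypothesis form) -/

section Remark410

variable {I : Type}

/-- **Remark, p. 410 [PDF 22] ll. 6–9**, verbatim: *«Let us make again the remark we made after Corollary 3.6. We have proved
the exponential decay of the propagator G′ using the expansion (3.90) and Lemma 2.1. We can get a decay rate arbitrarily close
to the decay rate of the localized propagators, hence to the decay rate of propagators without external gauge field.»* —
typed reading: `δloc` = the decay rate of the localized propagators G′_□ (an explicit parameter: the δ₀ of Corollary 3.6, i.e. of
[4] at U = 1); for every rate δ < δloc the conclusion of Theorem 3.1 (`B9.Ineq342_346_347`, `B9.Ineq343_345`, by name) holds for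
G′(U) with δ in place of δ₀, the thresholds M₂, a₀ and the constants now depending on δ (quantified AFTER δ, before the member i
and U, as "for M sufficiently large" is in Thm 3.7).  Kernel-checked instance of the mechanism for the sup entry:
`B9Thm37Sum.thm37_entry1_explicit` (rate (1 − α)δ₀, α free).  Hypothesis slot; nothing asserted.
[cite: Balaban1985BackgroundPropagators, remark p.410 (after the proof of Thm 3.7)] -/
def RemarkP410DecayRatePrinted (c35 : ℝ) (geo : I → Geometry) (bg : I → Backgrounds)
    (Gp : ∀ i, KernelFamily (geo i) (bg i)) (δloc : ℝ) : Prop :=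
  ∀ δ : ℝ, 0 < δ → δ < δloc →
    ∃ M₂ a₀ B₀ : ℝ, ∃ Bβ Bε : ℝ → ℝ, ∃ Bεβ : ℝ → ℝ → ℝ, 0 < M₂ ∧ 0 < a₀ ∧ 0 < B₀ ∧
      ∀ i : I, M₂ ≤ (geo i).M → ∀ α₀ : ℝ, 0 < α₀ → (geo i).M * α₀ ≤ a₀ →
        ∀ U : (bg i).Cfg, (bg i).Reg335 c35 α₀ U →
          Ineq342_346_347 (Gp i) B₀ δ U ∧ Ineq343_345 (Gp i) Bβ Bε Bεβ δ U

/-- Bookkeeping (kernel-checked): the remark as typed CONTAINS Theorem 3.1 for G′ — at any admissible rate 0 < δ < δloc it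
yields `B9.Thm31Printed` (whose δ₀ is existential). [cite: Balaban1985BackgroundPropagators, remark p.410 + Thm 3.1 p.397] -/
theorem thm31Printed_of_remarkP410 {c35 : ℝ} {geo : I → Geometry} {bg : I → Backgrounds}
    {Gp : ∀ i, KernelFamily (geo i) (bg i)} {δloc δ : ℝ} (hδ : 0 < δ) (hlt : δ < δloc)
    (h : RemarkP410DecayRatePrinted c35 geo bg Gp δloc) : Thm31Printed c35 geo bg Gp := by
  obtain ⟨M₂, a₀, B₀, Bβ, Bε, Bεβ, hM, ha, hB, H⟩ := h δ hδ hlt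
  exact ⟨M₂, δ, a₀, B₀, Bβ, Bε, Bεβ, hM, hδ, ha, hB, H⟩

end Remark410

section Partition

variable {X : Type*}

/-- **p. 411 [PDF 23]**, verbatim (first sum of (3.95), after the re-expansion): *«The characteristic function 1 − □̃ at the
beginning of the term, and the function h_□ at the end, restrict a kernel of the term to points separated at least by a distance
ML^jη (if □ ∈ 𝒟_j).»* — typed reading over explicit letters: `tildeBox` = □̃ and `supph` = supp h_□ as point sets of a metric
space, `ℓ` = L^jη; every point outside □̃ is at distance ≧ M·ℓ from every point of supp h_□.  This is the separation the
(2.83)-estimate of [4] consumes (`B9Thm39Sum.firstSum_term_majorant`, hypothesis `hsep`, there in the multiscale distance d).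
[cite: Balaban1985BackgroundPropagators, p.411 (proof of Thm 3.9, first sum of (3.95))] -/
def SeparationP411Printed [PseudoMetricSpace X] (tildeBox supph : Set X) (M ℓ : ℝ) : Prop :=
  ∀ x, x ∉ tildeBox → ∀ x' ∈ supph, M * ℓ ≤ dist x x'

/-- **p. 412 [PDF 24]**, verbatim: *«Let us notice that by the construction of the partition 𝒟′ we have h′_{□₀} = 1 on □̃, hence
we have only the function h′²_{□₀} in the above expression.»* — typed reading: the cut-off `hprime0` = h′_{□₀} of the modified
partition 𝒟′ (p. 411: *«Let us denote by □₀ the cube □̃² in the first case, and □̃₁² in the second. The partition 𝒟′ coincides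
with 𝒟 outside □₀.»*) equals 1 at every point of `tildeBox` = □̃.  Consumed as the locality inputs of `B9Eq395Small.regroup_412`
(`chi_comp_mulOp_eq_of_local`). [cite: Balaban1985BackgroundPropagators, p.412 (proof of Thm 3.9)] -/
def HprimeOneOnTildeP412Printed (tildeBox : Set X) (hprime0 : X → ℝ) : Prop :=
  ∀ x ∈ tildeBox, hprime0 x = 1

/-- **p. 414 [PDF 26]**, after (3.105), verbatim: *«where the function ζ_□̃ is defined similarly to h_□, i.e. ζ_□̃ ∈ C₀^∞(□̃) and
ζ_□̃ = 1 on a cube containing □, whose boundary is in a distance ≧ ⅔M to the boundary of □.»* — typed reading over explicit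
letters (`box` = □, `tildeBox` = □̃, `K` = the intermediate cube as a point set, `zeta` = ζ_□̃, `ℓ` = L^jη): □ ⊆ K, every point
within distance ⅔M·ℓ of □ lies in K (the reading of «whose boundary is in a distance ≧ ⅔M to the boundary of □»), ζ_□̃ = 1 on K, and
ζ_□̃ vanishes off □̃.  The smoothness «C₀^∞» (gradient bounds of [4] Sect. A) and the cube shape of K are not typed. [cite: Balaban1985BackgroundPropagators, p.414 (after (3.105))] -/
def ZetaOneNearBoxP414Printed [PseudoMetricSpace X] (box tildeBox K : Set X) (zeta : X → ℝ) (M ℓ : ℝ) : Prop :=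
  box ⊆ K ∧ (∀ x, (∃ x₀ ∈ box, dist x x₀ ≤ 2 / 3 * M * ℓ) → x ∈ K) ∧ (∀ x ∈ K, zeta x = 1) ∧
    ∀ x, zeta x ≠ 0 → x ∈ tildeBox

/-- **p. 414 [PDF 26]**, verbatim: *«This implies that supp h_□ is separated from supp (1 − ζ_□̃) by a distance ≧ M.»* (on the
L^{−j}-scale, `ℓ` = L^jη) — typed reading: every point where h_□ ≠ 0 is at distance ≧ M·ℓ from every point where ζ_□̃ ≠ 1.
The (1 − ζ_□̃)-term of (3.105) is small by this separation (p. 415). [cite: Balaban1985BackgroundPropagators, p.414 (after (3.105), supp h_□ vs supp (1 − ζ_□̃))] -/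
def ZetaSeparationP414Printed [PseudoMetricSpace X] (h zeta : X → ℝ) (M ℓ : ℝ) : Prop :=
  ∀ x, h x ≠ 0 → ∀ x', zeta x' ≠ 1 → M * ℓ ≤ dist x x'

/-- Bookkeeping (kernel-checked): under `ZetaSeparationP414Printed` with M·ℓ > 0 the two supports are disjoint pointwise —
where h_□ ≠ 0 one has ζ_□̃ = 1, i.e. *«ζ_□̃h_□ = h_□»* (p. 415; the algebraic input `hζ` of `B9Eq3105Sum.eq3105_sum`).
[cite: Balaban1985BackgroundPropagators, p.414 (after (3.105)) + p.415 (ζ_□̃h_□ = h_□)] -/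
theorem zeta_eq_one_of_separation [PseudoMetricSpace X] {h zeta : X → ℝ} {M ℓ : ℝ}
    (hsep : ZetaSeparationP414Printed h zeta M ℓ) (hMℓ : 0 < M * ℓ) {x : X} (hx : h x ≠ 0) : zeta x = 1 := by
  by_contra hz
  have := hsep x hx x hz
  rw [dist_self] at this
  exact absurd this (not_le.mpr hMℓ)

end Partition

section Eq397

variable {I : Type}

/-- **p. 412 [PDF 24]**, (3.97) and the [2]-estimate, verbatim: *«we take □̃Q′(G′²_{□₀} − G′²_□)Q′\*h_□C_□h_□. (3.97)  We have
proved in [2] that if we have a difference of propagators defined on two domains, then in an estimate of this difference we have,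
besides the usual factors connected with propagators of a considered type, an exponential factor with a distance between
localizations and a closest point where a change was made. Such inequalities were proved using only the random walk expansions,
hence they are valid for all propagators we have considered in [4]. By an argument similar to the one used in the proof of
Corollary 3.5, they are valid for propagators defined by sequences {Ω_j} with Ω₀ contained in a cube for which the condition
(3.25) is satisfied. Hence, they are valid in the considered case, and the differences □̃Q′(G′²_{□₀} − G′²_□)Q′\*□ can be estimated
by the usual factors multiplied by e^{−2δ₀M}. We have to notice only that the operators may differ outside □̃₀, and the distance
from □̃ to □̃₀ᶜ is at least M (on L^{−j}-scale).»* — typed reading over the carriers of `…B9` and explicit letters: for the member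
i, `ι i` indexes the cubes □ ∈ 𝒟, `Dk i □ U y y′` = the kernel on 𝔅 of the difference operator □̃Q′(G′²_{□₀} − G′²_□)Q′\*□ at U,
`F i □ U y y′` = *«the usual factors connected with propagators of a considered type»* (the bound of the same shape for ONE term
□̃Q′G′²_{□′}Q′\*□, □′ ∈ {□₀, □} — supplied by the consumer), `δ₀` = the rate of (3.42) ∕ (3.89); under the standing provisos of Theorem 3.9
("M sufficiently large", U in the class (3.35)) the difference kernel is bounded by F·e^{−2δ₀M}.  [2] = [Balaban1983RegularityDecay];
the estimate itself is cell GAPS G-B9-05 (by reference) — in the tree it is the hypothesis `hA` of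
`B9Eq395Small.smallFactor_term_majorant` and THEOREM D of `B9SectCDiffEstimate` (`EstHyp.core_diff_entry`).  Hypothesis slot.
[cite: Balaban1985BackgroundPropagators, (3.97) p.412] -/
def Eq397DifferenceFactorPrinted (c35 : ℝ) (geo : I → Geometry) (bg : I → Backgrounds) (ι : I → Type)
    (Dk F : ∀ i, ι i → (bg i).Cfg → (geo i).Site → (geo i).Site → ℝ) (δ₀ : ℝ) : Prop :=
  ∃ M₂ a₀ : ℝ, 0 < M₂ ∧ 0 < a₀ ∧
    ∀ i : I, M₂ ≤ (geo i).M → ∀ α₀ : ℝ, 0 < α₀ → (geo i).M * α₀ ≤ a₀ →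
      ∀ U : (bg i).Cfg, (bg i).Reg335 c35 α₀ U →
        ∀ (q : ι i) (y y' : (geo i).Site),
          |Dk i q U y y'| ≤ F i q U y y' * Real.exp (-(2 * δ₀ * (geo i).M))

/-- Bookkeeping (kernel-checked), p. 412: *«This exponential can be estimated by (2δ₀M)^{−1} and we consider the operator (3.97)
as on [sic] factor in the expansion.»* — with nonnegative usual factors, δ₀ > 0 and M > 0 the typed estimate gives
|Dk| ≦ F·(2δ₀M)^{−1}, by the cell's `B9.exp_neg_le_inv` (e^{−s} ≦ s^{−1}); cf. `B9Eq395Small.term397_small_factor`.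
[cite: Balaban1985BackgroundPropagators, p.412 (after (3.97))] -/
theorem eq397_factor_le_inv {c35 : ℝ} {geo : I → Geometry} {bg : I → Backgrounds} {ι : I → Type}
    {Dk F : ∀ i, ι i → (bg i).Cfg → (geo i).Site → (geo i).Site → ℝ} {δ₀ : ℝ} (hδ : 0 < δ₀)
    (hF : ∀ i q U y y', 0 ≤ F i q U y y') (h : Eq397DifferenceFactorPrinted c35 geo bg ι Dk F δ₀) :
    ∃ M₂ a₀ : ℝ, 0 < M₂ ∧ 0 < a₀ ∧
      ∀ i : I, M₂ ≤ (geo i).M → ∀ α₀ : ℝ, 0 < α₀ → (geo i).M * α₀ ≤ a₀ →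
        ∀ U : (bg i).Cfg, (bg i).Reg335 c35 α₀ U →
          ∀ (q : ι i) (y y' : (geo i).Site),
            |Dk i q U y y'| ≤ F i q U y y' * (2 * δ₀ * (geo i).M)⁻¹ := by
  obtain ⟨M₂, a₀, hM, ha, H⟩ := h
  refine ⟨M₂, a₀, hM, ha, fun i hMi α₀ hα hMa U hU q y y' => ?_⟩
  have hMpos : 0 < (geo i).M := lt_of_lt_of_le hM hMi
  have hs : 0 < 2 * δ₀ * (geo i).M := by positivity
  exact (H i hMi α₀ hα hMa U hU q y y').trans
    (mul_le_mul_of_nonneg_left (exp_neg_le_inv _ hs) (hF i q U y y'))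

end Eq397

section Domains

variable {κ X : Type*}

/-- **Connected families of cubes, p. 413 [PDF 25]**, verbatim: *«More generally, we consider a class of localization domains, each
domain is a union of a connected, finite family of cubes from 𝒟. A connected family means that for every pair □, □′ of cubes from
the family there exists a sequence □₁, …, □ₘ of cubes belonging to the family and such that □ ∩ □₁ ≠ ∅, □₁ ∩ □₂ ≠ ∅, …,
□ₘ ∩ □′ ≠ ∅.»* — definition with body: `cube q` = the point set of the cube q ∈ 𝒟 (`κ` indexes 𝒟); the finite family `F` is
connected iff any two members are joined by a chain INSIDE `F` of consecutively intersecting cubes (the reflexive–transitive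
closure of «both in F and meeting»; the printed sequence may be empty, which for nonempty cubes is the case m = 1, □₁ = □).
Same shape as [B13]'s `B13MayerDecoupling.Linked`. [cite: Balaban1985BackgroundPropagators, p.413 (connected family of cubes)] -/
def IsConnectedFamily (cube : κ → Set X) (F : Finset κ) : Prop :=
  ∀ q ∈ F, ∀ q' ∈ F, Relation.ReflTransGen (fun a b : κ => a ∈ F ∧ b ∈ F ∧ (cube a ∩ cube b).Nonempty) q q'

/-- **Localization domains, p. 413 [PDF 25]**, verbatim: *«A sum of these cubes determines a localization domain X i.e.
X = □₁ ∪ □₂ ∪ …»* — definition with body: the union of the cubes of the finite family `F`.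
[cite: Balaban1985BackgroundPropagators, p.413 (localization domain X = □₁ ∪ □₂ ∪ …)] -/
def locDomain (cube : κ → Set X) (F : Finset κ) : Set X := ⋃ q ∈ F, cube q

/-- **p. 413 [PDF 25]**: *«each domain is a union of a connected, finite family of cubes from 𝒟»* — the point set `Xs` IS a
localization domain: it is `locDomain` of some nonempty connected finite family.  (p. 413: *«We consider only very small families,
containing several cubes. A biggest is connected with operators localized in □₀, which is a sum of 5^d cubes from 𝒟»* — the count
5^d is `B9SectCCubes.card_shifts` ∕ `box0_eq`; no size bound is part of the printed definition.)
[cite: Balaban1985BackgroundPropagators, p.413 (class of localization domains)] -/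
def IsLocalizationDomainPrinted (cube : κ → Set X) (Xs : Set X) : Prop :=
  ∃ F : Finset κ, F.Nonempty ∧ IsConnectedFamily cube F ∧ Xs = locDomain cube F

/-- A cube of the family lies in its localization domain. [cite: Balaban1985BackgroundPropagators, p.413 (X = □₁ ∪ □₂ ∪ …)] -/
theorem subset_locDomain (cube : κ → Set X) {F : Finset κ} {q : κ} (hq : q ∈ F) : cube q ⊆ locDomain cube F := by
  intro x hx
  simp only [locDomain, Set.mem_iUnion]
  exact ⟨q, hq, hx⟩

/-- The localization domain of a single cube is that cube (p. 413: *«R′₀(□) = h_□C_□h_□, R′₀(X) = 0 for localization domains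
bigger than a cube from 𝒟»* — the head domains X₀ are single cubes). [cite: Balaban1985BackgroundPropagators, p.413 (R′₀(□) = h_□C_□h_□)] -/
theorem locDomain_singleton (cube : κ → Set X) (q : κ) : locDomain cube {q} = cube q := by
  ext x
  simp [locDomain]

/-- A single cube is a connected family (the empty chain). [cite: Balaban1985BackgroundPropagators, p.413 (connected family of cubes)] -/
theorem isConnectedFamily_singleton (cube : κ → Set X) (q : κ) : IsConnectedFamily cube {q} := by
  intro a ha b hb
  rw [Finset.mem_singleton] at ha hb
  subst ha; subst hb
  exact Relation.ReflTransGen.refl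

/-- Two intersecting cubes form a connected family (the walk condition X_{i−1} ∩ X_i ≠ ∅ of (3.98) chains such pairs).
[cite: Balaban1985BackgroundPropagators, p.413 (connected family of cubes) + (3.98) p.413] -/
theorem isConnectedFamily_pair [DecidableEq κ] (cube : κ → Set X) {q q' : κ} (h : (cube q ∩ cube q').Nonempty) :
    IsConnectedFamily cube {q, q'} := by
  have hq : q ∈ ({q, q'} : Finset κ) := by simp
  have hq' : q' ∈ ({q, q'} : Finset κ) := by simp
  have hsymm : (cube q' ∩ cube q).Nonempty := by rwa [Set.inter_comm]
  intro a ha b hb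
  simp only [Finset.mem_insert, Finset.mem_singleton] at ha hb
  rcases ha with rfl | rfl <;> rcases hb with rfl | rfl
  · exact Relation.ReflTransGen.refl
  · exact Relation.ReflTransGen.single ⟨hq, hq', h⟩
  · exact Relation.ReflTransGen.single ⟨hq', hq, hsymm⟩
  · exact Relation.ReflTransGen.refl

/-- A single cube is a localization domain. [cite: Balaban1985BackgroundPropagators, p.413 (class of localization domains)] -/
theorem isLocalizationDomain_cube (cube : κ → Set X) (q : κ) : IsLocalizationDomainPrinted cube (cube q) :=
  ⟨{q}, Finset.singleton_nonempty q, isConnectedFamily_singleton cube q, (locDomain_singleton cube q).symm⟩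

/-- **p. 413 [PDF 25]**, verbatim: *«An operator R(X) has the following important properties: it is localized in X, i.e. its
kernel has a support in X × X, it depends on U restricted to X̃⁵, and satisfies a bound of the type (3.89), possibly with an
additional power of L^jη. It is difficult to make the last statement more precise. Instead we will write a bound for a whole
term in the expansion.»* — typed reading of the FIRST clause over explicit letters: `A` indexes the factors (α, X), `Xs a` = the
point set of X, `K a U` = the kernel of R′_α(X) at the configuration U; the kernel vanishes unless both arguments lie in X.  The
second clause (U-dependence through X̃⁵) is `B9Thm39Whole.Locality39.rw` ∕ `B9Locality.IsLocalIn` in the tree; the third is,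
as print says, only the whole-term bound (3.99) (`B9.Thm39Printed`; factor shape `B9Thm39Whole.Factors389`, source side).
[cite: Balaban1985BackgroundPropagators, p.413 (properties of R(X))] -/
def RFactorKernelSupportP413Printed {A S C : Type*} (Xs : A → Set S) (K : A → C → S → S → ℝ) : Prop :=
  ∀ (a : A) (U : C) (x x' : S), K a U x x' ≠ 0 → x ∈ Xs a ∧ x' ∈ Xs a

end Domains

/-! ## §2 The bundle keyed to the consumer (K1⁷ `stmt-QuantumFields-20542`, lane N06 [B9]) -/

section Bundle

variable {I : Type}

/-- **BLOCK 08 BUNDLE — Corollary 3.8, its last sentence, Theorem 3.9 and «This theorem implies Theorem 3.2», BY NAME.**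
Fields: `c38` = `B9.Cor38Printed` (p. 410, (3.93)–(3.94), sup entry); `c38an` = `B9SectCWalkTermsAllNorms.Cor38AllNormsPrinted`
(p. 410 *«Similar estimates hold for the other norms»*, the ω-terms seen through the walk-indexed family `termK`); `t39` =
`B9.Thm39Printed` (p. 413, (3.98)–(3.99)); `ksum` = `B9.RWKernelSumYields` (p. 413 *«This theorem implies Theorem 3.2.»*, the
kernel-summation leaf).  Parameters as the consumer holds them (`DagBinding.PrintedCarriers9`: `E37`, `EK39`, `Cinv`).  A node
prover takes `(h : Hyp d c35 geo bg E37 termK EK39 Cinv)`; the displayed hypotheses under which the tree INHABITS these fields are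
`B9Cor38Whole.cor38Printed_of_local342`, `B9Thm39Whole.thm39Printed_of_local348`, `B9Thm39Whole.rwKernelSumYields_EK39OfOps`.
Hypothesis slot only. [cite: Balaban1985BackgroundPropagators, Cor. 3.8 p.410 + Thm 3.9 p.413] -/
structure Hyp (d : ℕ) (c35 : ℝ) (geo : I → Geometry) (bg : I → Backgrounds)
    (E37 : ∀ i, RWExpansion (geo i) (bg i)) (termK : ∀ i, (E37 i).Walk → KernelFamily (geo i) (bg i))
    (EK39 : ∀ i, RWKernelExpansion (geo i) (bg i)) (Cinv : ∀ i, SiteKernel (geo i) (bg i)) : Prop where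
  c38 : Cor38Printed c35 geo bg E37
  c38an : B9SectCWalkTermsAllNorms.Cor38AllNormsPrinted c35 geo bg E37 termK
  t39 : Thm39Printed d c35 geo bg EK39
  ksum : RWKernelSumYields d geo bg EK39 Cinv

variable {d : ℕ} {c35 : ℝ} {geo : I → Geometry} {bg : I → Backgrounds}
  {E37 : ∀ i, RWExpansion (geo i) (bg i)} {termK : ∀ i, (E37 i).Walk → KernelFamily (geo i) (bg i)}
  {EK39 : ∀ i, RWKernelExpansion (geo i) (bg i)} {Cinv : ∀ i, SiteKernel (geo i) (bg i)}

/-- **p. 413 [PDF 25]: «This theorem implies Theorem 3.2.»** — from the bundle, Theorem 3.2 (3.48) for the kernel `Cinv`, by the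
cell's `B9.thm32_of_thm39`. [cite: Balaban1985BackgroundPropagators, Thm 3.9 ⇒ Thm 3.2 p.413] -/
theorem Hyp.t32 (h : Hyp d c35 geo bg E37 termK EK39 Cinv) : Thm32Printed d c35 geo bg Cinv :=
  thm32_of_thm39 d c35 geo bg EK39 Cinv h.t39 h.ksum

/-- When the expansion carrier's `term` IS the sup entry of the walk-indexed family, the all-norms field already contains the
sup-only Corollary 3.8 (`B9SectCWalkTermsAllNorms.cor38Printed_of_allNorms`), so the bundle is assembled from three inputs.
[cite: Balaban1985BackgroundPropagators, Cor. 3.8 (3.94) p.410] -/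
theorem Hyp.of_allNorms
    (hterm : ∀ (i : I) (U : (bg i).Cfg) (ω : (E37 i).Walk) (lam : (geo i).Loc) (y : (geo i).Site),
      (E37 i).term U ω lam y = (termK i ω).e 0 U lam y)
    (h38 : B9SectCWalkTermsAllNorms.Cor38AllNormsPrinted c35 geo bg E37 termK)
    (h39 : Thm39Printed d c35 geo bg EK39) (hks : RWKernelSumYields d geo bg EK39 Cinv) :
    Hyp d c35 geo bg E37 termK EK39 Cinv :=
  ⟨B9SectCWalkTermsAllNorms.cor38Printed_of_allNorms hterm h38, h38, h39, hks⟩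

/-- The (3.99) line of the bundle, one walk at a time: the ω-term kernel of (3.98) at (y, y′) is bounded by
(L^jη)^{−4}(L^{j′}η)^{−d}·`B9.walkFactor C c M δ₀ |ω| d(ω,y,y′)` under the provisos of Theorem 3.9.
[cite: Balaban1985BackgroundPropagators, Thm 3.9 (3.99) p.413] -/
theorem Hyp.kterm_le (h : Hyp d c35 geo bg E37 termK EK39 Cinv) :
    ∃ M₂ a₀ δ₀ C c : ℝ, 0 < M₂ ∧ 0 < a₀ ∧ 0 < δ₀ ∧ 0 < C ∧ 0 < c ∧
      ∀ i : I, M₂ ≤ (geo i).M → ∀ α₀ : ℝ, 0 < α₀ → (geo i).M * α₀ ≤ a₀ →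
        ∀ U : (bg i).Cfg, (bg i).Reg335 c35 α₀ U →
          ∀ (ω : (EK39 i).Walk) (y y' : (geo i).Site),
            |(EK39 i).kterm U ω y y'| ≤ ((geo i).len y) ^ (-(4 : ℝ)) * ((geo i).len y') ^ (-(d : ℝ)) *
              walkFactor C c (geo i).M δ₀ ((EK39 i).wlen ω) ((EK39 i).wdist ω y y') := by
  obtain ⟨M₂, a₀, δ₀, C, c, hM, ha, hδ, hC, hc, H⟩ := h.t39
  exact ⟨M₂, a₀, δ₀, C, c, hM, ha, hδ, hC, hc,
    fun i hMi α₀ hα hMa U hU ω y y' => ((H i hMi α₀ hα hMa U hU).2 ω y y').2⟩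

end Bundle

section AtRecord

/-- **The bundle keyed to the consumer's carrier record** `DagBinding.PrintedCarriers9` (the record over which N06's leaf
`DagBinding.B9Leaf` is stated; `PrintedCarriers9X` extends it): `Hyp` at `Y.d9, Y.c35, Y.geo9, Y.bg9, Y.E37, Y.EK39, Y.Cinv`, the
walk-indexed kernel family `termK` of the all-norms sentence being the one extra carrier.
[cite: Balaban1985BackgroundPropagators, Cor. 3.8 p.410 + Thm 3.9 p.413 (bundle at the record)] -/
def HypAt (Y : PrintedCarriers9) (termK : ∀ i, (Y.E37 i).Walk → KernelFamily (Y.geo9 i) (Y.bg9 i)) : Prop :=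
  Hyp Y.d9 Y.c35 Y.geo9 Y.bg9 Y.E37 termK Y.EK39 Y.Cinv

variable (Y : PrintedCarriers9) (termK : ∀ i, (Y.E37 i).Walk → KernelFamily (Y.geo9 i) (Y.bg9 i))

/-- `HypAt` unfolds to `Hyp` at the record's carriers. [cite: Balaban1985BackgroundPropagators, Cor. 3.8 p.410 + Thm 3.9 p.413 (bookkeeping)] -/
theorem hypAt_iff : HypAt Y termK ↔ Hyp Y.d9 Y.c35 Y.geo9 Y.bg9 Y.E37 termK Y.EK39 Y.Cinv := Iff.rfl

/-- **The B9 leaf plus the two Sect. C extras give the block**: `DagBinding.B9Leaf Y` (fields `c38`, `t39`), Corollary 3.8's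
all-norms sentence and the kernel-summation leaf (`B9LeafKnit`'s `hksum`) assemble `HypAt Y`.
[cite: Balaban1985BackgroundPropagators, Cor. 3.8 p.410 + Thm 3.9 p.413 (leaf ⇒ bundle)] -/
theorem hypAt_of_b9Leaf (hL : B9Leaf Y) (hall : B9SectCWalkTermsAllNorms.Cor38AllNormsPrinted Y.c35 Y.geo9 Y.bg9 Y.E37 termK)
    (hksum : RWKernelSumYields Y.d9 Y.geo9 Y.bg9 Y.EK39 Y.Cinv) : HypAt Y termK :=
  ⟨hL.c38, hall, hL.t39, hksum⟩

/-- Conversely the block bundle returns the leaf fields it is responsible for (`B9Leaf.c38`, `B9Leaf.t39`), the knit's `hksum`,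
and Theorem 3.2 for `Y.Cinv` (*«This theorem implies Theorem 3.2»*), in the leaf's own types.
[cite: Balaban1985BackgroundPropagators, Cor. 3.8 p.410 + Thm 3.9 p.413 (bundle ⇒ leaf fields)] -/
theorem HypAt.leafFields (h : HypAt Y termK) :
    Cor38Printed Y.c35 Y.geo9 Y.bg9 Y.E37 ∧ Thm39Printed Y.d9 Y.c35 Y.geo9 Y.bg9 Y.EK39 ∧
      RWKernelSumYields Y.d9 Y.geo9 Y.bg9 Y.EK39 Y.Cinv ∧ Thm32Printed Y.d9 Y.c35 Y.geo9 Y.bg9 Y.Cinv :=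
  ⟨h.c38, h.t39, h.ksum, Hyp.t32 h⟩

end AtRecord

end Literature.MathematicalPhysics.QuantumFieldTheory.Balaban1983to89.B9Carve08Thm39Hyp
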